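import Literature.MathematicalPhysics.QuantumLattice.FermionGateDressingLightCone
import HarnessLib

/-!
# Product states over boxes: marginals on a window whose PARTS are indexed separately from the boxes, and the
# light cone placed inside a window for a SUB-family of gates

Topic `Literature/MathematicalPhysics/QuantumLattice` (namespace = path; family `hubbard`, model-free). Two
re-indexed forms of `FermionBoxProductMarginals.fermionPartialTrace_boxProd` and
`FermionGateDressingLightCone.conjTranspose_boxProd_mul_fermionEmbed_mul_eq`, needed when a small window meets only a
few of very many boxes / gates (the torus assembly of the `T > 0` Hubbard certificate C3: a dressed Hamiltonian term
sees `≤ 4` of the `K_x K_y` boxes and `≤ 2` of the `m K_x K_y` gates):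

* `noncommProd_map_of_embedding` — re-indexing a commuting product along an injection of index types;
* `fermionPartialTrace_boxProd_parts` — boxes `φ_k : Λ₀ k ↪ Λ` (`k ∈ K`) tiling `Λ`, even box density matrices `σ_k`
  (`tr σ_k = 1`); a window `ι : Ω ↪ Λ` partitioned into parts `lam k' : P k' ↪ Ω` indexed by ANOTHER finite type `K'`,
  each part lying in the box `bx k'` (`bx : K' → K` injective, `φ_{bx k'} ∘ κ_{k'} = ι ∘ lam_{k'}`). Then
  `tr_ι (Π_k Γ_{φ_k} σ_k) = Π_{k'} Γ_{lam k'} (tr_{κ k'} σ_{bx k'})` — the boxes not met contribute `tr σ_k = 1`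
  [cite: ArakiMoriya2003, §4.1 Def. 4.5, §11.1 Theorem 11.2];
* `conjTranspose_boxProd_map_mul_fermionEmbed_mul_eq` — for gates `φ_k` (`k ∈ K`) and a sub-family `e : K' ↪ K` placed
  inside a window `ω : Ω ↪ Λ` by legs `ψ k' : Λ₀ (e k') ↪ Ω` (`φ_{e k'} = ω ∘ ψ_{k'}`):
  `W_{e(K')}ᴴ · Γ_{ι'≫ω}(x) · W_{e(K')} = Γ_ω (W'ᴴ · Γ_{ι'} x · W')` with `W' = Π_{k'} Γ_{ψ k'} u_{e k'}` a matrix on the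
  window [cite: BratteliRobinsonII1997, §5.2.2].

Everything is PROVED; no definition, no named fact.

## References

* H. Araki, H. Moriya, Rev. Math. Phys. 15 (2003) 93, §4.1, §11.1 Thm. 11.2. [cite: ArakiMoriya2003, §11.1 Theorem 11.2]
* O. Bratteli, D. W. Robinson, *Operator Algebras and Quantum Statistical Mechanics 2* (1997), §5.2.2.
  [cite: BratteliRobinsonII1997, §5.2.2]
-/

noncomputable section

namespace Literature.MathematicalPhysics.QuantumLattice

open Matrix Finset HubbardWave0
open scoped ComplexOrder BigOperators

/-! ### §0. Re-indexing commuting products -/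

section Reindex

variable {α β γ : Type*} [Monoid γ]

/-- **Re-indexing a commuting product along an injection**: `Π_{b ∈ e(s)} f b = Π_{a ∈ s} f (e a)`.
[cite: BratteliRobinsonII1997, §5.2.2] -/
theorem noncommProd_map_of_embedding [DecidableEq β] (s : Finset α) (e : α ↪ β) (f : β → γ)
    (comm : ((s.map e : Finset β) : Set β).Pairwise fun x y => Commute (f x) (f y)) :
    (s.map e).noncommProd f comm =
      s.noncommProd (fun a => f (e a))
        (fun _ ha _ ha' h => comm (Finset.mem_coe.2 (Finset.mem_map_of_mem e ha))
          (Finset.mem_coe.2 (Finset.mem_map_of_mem e ha')) (fun h' => h (e.injective h'))) := by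
  classical
  induction s using Finset.induction_on with
  | empty => simp
  | insert a s has ih =>
    have has' : e a ∉ s.map e := fun h => has ((Finset.mem_map' e).1 h)
    simp_rw [Finset.map_insert]
    rw [Finset.noncommProd_insert_of_notMem _ _ _ _ has', Finset.noncommProd_insert_of_notMem _ _ _ _ has, ih]

end Reindex

/-! ### §1. Marginals with independently indexed parts -/

section Parts

variable {Λ : Type*} [LinearOrder Λ] [Fintype Λ] {K : Type*} [Fintype K] [DecidableEq K]
  {Λ₀ : K → Type*} [∀ k, LinearOrder (Λ₀ k)] [∀ k, Fintype (Λ₀ k)]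
  {φ : ∀ k, Λ₀ k ↪ Λ}
  (hφ : ∀ k j, k ≠ j → Disjoint ((Finset.univ : Finset (Λ₀ k)).map (φ k)) ((Finset.univ : Finset (Λ₀ j)).map (φ j)))
  -- the window, its parts (indexed by `K'`), and the box of each part
  {Ω : Type*} [LinearOrder Ω] [Fintype Ω] (ι : Ω ↪ Λ)
  {K' : Type*} [Fintype K'] [DecidableEq K'] (bx : K' → K) (hbx : Function.Injective bx)
  {P : K' → Type*} [∀ k', LinearOrder (P k')] [∀ k', Fintype (P k')]
  (κ : ∀ k', P k' ↪ Λ₀ (bx k')) (lam : ∀ k', P k' ↪ Ω)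
  (hlam : ∀ k' j', k' ≠ j' → Disjoint ((Finset.univ : Finset (P k')).map (lam k')) ((Finset.univ : Finset (P j')).map (lam j')))
  (hcompat : ∀ k' x, φ (bx k') (κ k' x) = ι (lam k' x))
  (cls : Ω → K') (pos : ∀ y, P (cls y)) (hpos : ∀ y, lam (cls y) (pos y) = y)
include hφ hbx hcompat hpos

omit hφ hbx hcompat hpos in
/-- Orbital count: `|Orb X| = 2 |X|` (re-derived locally). [folklore] -/
private theorem card_orb_eq_two_mul'' (X : Type*) [LinearOrder X] [Fintype X] :
    Fintype.card (Orb X) = 2 * Fintype.card X := by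
  rw [Fintype.card_congr (show Orb X ≃ X × Fin 2 from (toLex : X × Fin 2 ≃ Orb X).symm), Fintype.card_prod,
    Fintype.card_fin, mul_comm]

/-- **The marginal of a product state on a window is the product of the part marginals** — parts indexed by their
own type `K'`, each lying in the box `bx k'` (`bx` injective). For `Θ`-even box density matrices `σ_k` (`tr σ_k = 1`)
on boxes tiling `Λ` (`Σ_k |Λ₀ k| = |Λ|`) and a window partitioned by the parts (`Σ_{k'} |P k'| = |Ω|`, every window
site in some part): `tr_ι (Π_k Γ_{φ_k} σ_k) = Π_{k'} Γ_{lam k'} (tr_{κ k'} σ_{bx k'})`.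
[cite: ArakiMoriya2003, §4.1 Def. 4.5] [cite: ArakiMoriya2003, §11.1 Theorem 11.2] -/
theorem fermionPartialTrace_boxProd_parts {σ : ∀ k, Matrix (Finset (Orb (Λ₀ k))) (Finset (Orb (Λ₀ k))) ℂ}
    (hσ : ∀ k, parityAut (σ k) = σ k) (htr : ∀ k, (σ k).trace = 1)
    (hcardΛ : ∑ k, Fintype.card (Λ₀ k) = Fintype.card Λ) (hcardΩ : ∑ k', Fintype.card (P k') = Fintype.card Ω) :
    fermionPartialTrace ι (boxProd hφ σ hσ Finset.univ) =
      boxProd hlam (fun k' => fermionPartialTrace (κ k') (σ (bx k')))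
        (fun k' => parityAut_fermionPartialTrace_of_even _ (hσ (bx k'))) Finset.univ := by
  set m : ∀ k', Matrix (Finset (Orb (P k'))) (Finset (Orb (P k'))) ℂ :=
    fun k' => fermionPartialTrace (κ k') (σ (bx k')) with hm
  have hmev : ∀ k', parityAut (m k') = m k' := fun k' => parityAut_fermionPartialTrace_of_even _ (hσ (bx k'))
  symm
  refine eq_fermionPartialTrace_of_forall_trace_mul ι _ fun A => ?_
  have hA : A ∈ Submodule.span ℂ {M | ∃ w : List (JWLetter (Orb Ω)), LettersIn Finset.univ w ∧ wordOp w = M} :=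
    mem_span_wordOp_of_mem_carSubalgebra (by rw [carSubalgebra_univ_eq_top]; exact Algebra.mem_top)
  refine Submodule.span_induction (p := fun A _ => (A * boxProd hlam m hmev Finset.univ).trace =
      (fermionEmbed ι A * boxProd hφ σ hσ Finset.univ).trace) ?_ ?_ ?_ ?_ hA
  · rintro _ ⟨w, -, rfl⟩
    obtain ⟨n, b, hw⟩ := exists_wordOp_eq_sign_smul_prod_parts lam cls pos w hpos
    rw [hw, Matrix.smul_mul, Matrix.trace_smul, map_smul, Matrix.smul_mul, Matrix.trace_smul]
    congr 1
    set l := (Finset.univ : Finset K').toList with hl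
    have hlnd : l.Nodup := Finset.nodup_toList _
    -- nodup / complement bookkeeping for the two sigma lists
    have hfst₁ : ((l.map fun k' => (⟨k', b k'⟩ : Σ j : K', Matrix (Finset (Orb (P j))) (Finset (Orb (P j))) ℂ)).map
        Sigma.fst) = l := by
      rw [List.map_map]
      exact List.map_id'' (fun _ => rfl) l
    have hnd₁ : ((l.map fun k' => (⟨k', b k'⟩ : Σ j : K', Matrix (Finset (Orb (P j))) (Finset (Orb (P j))) ℂ)).map
        Sigma.fst).Nodup := by
      rw [hfst₁]
      exact hlnd
    have hsd₁ : Finset.univ \ ((l.map fun k' => (⟨k', b k'⟩ :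
        Σ j : K', Matrix (Finset (Orb (P j))) (Finset (Orb (P j))) ℂ)).map Sigma.fst).toFinset = (∅ : Finset K') := by
      rw [hfst₁, Finset.sdiff_eq_empty_iff_subset]
      exact fun k _ => List.mem_toFinset.2 (Finset.mem_toList.2 (Finset.mem_univ k))
    have hfst₂ : ((l.map fun k' => (⟨bx k', fermionEmbed (κ k') (b k')⟩ :
        Σ j : K, Matrix (Finset (Orb (Λ₀ j))) (Finset (Orb (Λ₀ j))) ℂ)).map Sigma.fst) = l.map bx := by
      rw [List.map_map]
      rfl
    have hnd₂ : ((l.map fun k' => (⟨bx k', fermionEmbed (κ k') (b k')⟩ :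
        Σ j : K, Matrix (Finset (Orb (Λ₀ j))) (Finset (Orb (Λ₀ j))) ℂ)).map Sigma.fst).Nodup := by
      rw [hfst₂]
      exact hlnd.map hbx
    have hsd₂ : Finset.univ \ ((l.map fun k' => (⟨bx k', fermionEmbed (κ k') (b k')⟩ :
        Σ j : K, Matrix (Finset (Orb (Λ₀ j))) (Finset (Orb (Λ₀ j))) ℂ)).map Sigma.fst).toFinset =
        Finset.univ \ Finset.univ.image bx := by
      rw [hfst₂]
      congr 1
      ext k
      simp [hl]
    have htwoΩ : ∀ X : Matrix (Finset (Orb Ω)) (Finset (Orb Ω)) ℂ, X.trace = 2 ^ Fintype.card (Orb Ω) * normTrace X :=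
      fun X => by rw [normTrace_apply, mul_div_assoc', mul_div_cancel_left₀ _ (pow_ne_zero _ two_ne_zero)]
    have htwoΛ : ∀ X : Matrix (Finset (Orb Λ)) (Finset (Orb Λ)) ℂ, X.trace = 2 ^ Fintype.card (Orb Λ) * normTrace X :=
      fun X => by rw [normTrace_apply, mul_div_assoc', mul_div_cancel_left₀ _ (pow_ne_zero _ two_ne_zero)]
    -- window side
    have hΩ : ((l.map fun k' => fermionEmbed (lam k') (b k')).prod * boxProd hlam m hmev Finset.univ).trace =
        2 ^ Fintype.card (Orb Ω) * (l.map fun k' => normTrace (m k' * b k')).prod := by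
      have h := normTrace_boxProd_mul_prod hlam hmev Finset.univ
        (l.map fun k' => (⟨k', b k'⟩ : Σ j : K', Matrix (Finset (Orb (P j))) (Finset (Orb (P j))) ℂ))
        hnd₁ (fun p _ => Finset.mem_univ _)
      rw [hsd₁, Finset.prod_empty, mul_one] at h
      simp only [List.map_map, Function.comp_def] at h
      rw [Matrix.trace_mul_comm, htwoΩ, h]
    -- ambient side
    have hemb : fermionEmbed ι (l.map fun k' => fermionEmbed (lam k') (b k')).prod =
        (l.map fun k' => fermionEmbed (φ (bx k')) (fermionEmbed (κ k') (b k'))).prod := by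
      rw [map_list_prod, List.map_map]
      refine congrArg List.prod (List.map_congr_left fun k' _ => ?_)
      simp only [Function.comp_apply]
      rw [fermionEmbed_fermionEmbed, fermionEmbed_fermionEmbed]
      exact congrFun (congrArg DFunLike.coe (fermionEmbed_congr fun x => (hcompat k' x).symm)) (b k')
    have hΛ : (fermionEmbed ι (l.map fun k' => fermionEmbed (lam k') (b k')).prod * boxProd hφ σ hσ Finset.univ).trace =
        2 ^ Fintype.card (Orb Λ) * ((l.map fun k' => normTrace (σ (bx k') * fermionEmbed (κ k') (b k'))).prod *
          ∏ k ∈ Finset.univ \ Finset.univ.image bx, normTrace (σ k)) := by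
      have h := normTrace_boxProd_mul_prod hφ hσ Finset.univ
        (l.map fun k' => (⟨bx k', fermionEmbed (κ k') (b k')⟩ :
          Σ j : K, Matrix (Finset (Orb (Λ₀ j))) (Finset (Orb (Λ₀ j))) ℂ))
        hnd₂ (fun p _ => Finset.mem_univ _)
      rw [hsd₂] at h
      simp only [List.map_map, Function.comp_def] at h
      rw [hemb, Matrix.trace_mul_comm, htwoΛ, h]
    rw [hΩ, hΛ]
    -- termwise identification
    have hterm : ∀ k', normTrace (m k' * b k') =
        (2 : ℂ) ^ Fintype.card (Orb (Λ₀ (bx k'))) / 2 ^ Fintype.card (Orb (P k')) *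
          normTrace (σ (bx k') * fermionEmbed (κ k') (b k')) := by
      intro k'
      rw [normTrace_apply, normTrace_apply, Matrix.trace_mul_comm, hm, trace_mul_fermionPartialTrace,
        Matrix.trace_mul_comm, div_mul_div_comm, mul_comm ((2 : ℂ) ^ _),
        mul_div_mul_right _ _ (pow_ne_zero _ two_ne_zero)]
    simp_rw [hterm]
    -- the unmatched boxes contribute `τ(σ_k) = 2^{-|Orb Λ₀ k|}`
    have hunm : ∏ k ∈ Finset.univ \ Finset.univ.image bx, normTrace (σ k) =
        ∏ k ∈ Finset.univ \ Finset.univ.image bx, ((2 : ℂ) ^ Fintype.card (Orb (Λ₀ k)))⁻¹ := by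
      refine Finset.prod_congr rfl fun k _ => ?_
      rw [normTrace_apply, htr, one_div]
    -- powers of two: `Π_{k'} 2^{N_{bx k'}} · Π_{k ∉ image bx} 2^{N_k} = 2^{|Orb Λ|}`, `Π_{k'} 2^{N_{P k'}} = 2^{|Orb Ω|}`
    have hΛpow : (∏ k' : K', (2 : ℂ) ^ Fintype.card (Orb (Λ₀ (bx k')))) *
        ∏ k ∈ Finset.univ \ Finset.univ.image bx, (2 : ℂ) ^ Fintype.card (Orb (Λ₀ k)) = 2 ^ Fintype.card (Orb Λ) := by
      rw [← Finset.prod_image (s := Finset.univ) (g := bx) (f := fun k => (2 : ℂ) ^ Fintype.card (Orb (Λ₀ k)))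
        (fun k' _ j' _ h => hbx h), mul_comm, Finset.prod_sdiff (Finset.subset_univ _), Finset.prod_pow_eq_pow_sum,
        card_orb_eq_two_mul'']
      simp_rw [card_orb_eq_two_mul'']
      rw [← Finset.mul_sum, hcardΛ]
    have hΩpow : ∏ k' : K', (2 : ℂ) ^ Fintype.card (Orb (P k')) = 2 ^ Fintype.card (Orb Ω) := by
      rw [Finset.prod_pow_eq_pow_sum, card_orb_eq_two_mul'']
      simp_rw [card_orb_eq_two_mul'']
      rw [← Finset.mul_sum, hcardΩ]
    have hB : ∏ k' : K', (2 : ℂ) ^ Fintype.card (Orb (P k')) ≠ 0 :=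
      Finset.prod_ne_zero_iff.2 fun k _ => pow_ne_zero _ two_ne_zero
    have hC : ∏ k ∈ Finset.univ \ Finset.univ.image bx, (2 : ℂ) ^ Fintype.card (Orb (Λ₀ k)) ≠ 0 :=
      Finset.prod_ne_zero_iff.2 fun k _ => pow_ne_zero _ two_ne_zero
    rw [hunm, Finset.prod_inv_distrib, ← hΩpow, ← hΛpow, hl]
    simp only [Finset.prod_map_toList]
    rw [Finset.prod_mul_distrib, Finset.prod_div_distrib]
    field_simp
  · rw [zero_mul, map_zero, zero_mul, Matrix.trace_zero, Matrix.trace_zero]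
  · intro x y _ _ hx hy
    rw [add_mul, Matrix.trace_add, map_add, add_mul, Matrix.trace_add, hx, hy]
  · intro c x _ hx
    rw [Matrix.smul_mul, Matrix.trace_smul, map_smul, Matrix.smul_mul, Matrix.trace_smul, hx]

end Parts

/-! ### §2. The light cone placed inside a window, for a sub-family of gates -/

section LightCone

variable {Λ : Type*} [LinearOrder Λ] [Fintype Λ] {K : Type*} [DecidableEq K]
  {Λ₀ : K → Type*} [∀ k, LinearOrder (Λ₀ k)] [∀ k, Fintype (Λ₀ k)]
  {φ : ∀ k, Λ₀ k ↪ Λ}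
  (hφ : ∀ k j, k ≠ j → Disjoint ((Finset.univ : Finset (Λ₀ k)).map (φ k)) ((Finset.univ : Finset (Λ₀ j)).map (φ j)))
  {a : ∀ k, Matrix (Finset (Orb (Λ₀ k))) (Finset (Orb (Λ₀ k))) ℂ} (ha : ∀ k, parityAut (a k) = a k)
  {Ω : Type*} [LinearOrder Ω] [Fintype Ω] (ω : Ω ↪ Λ)
  {K' : Type*} [Fintype K'] (e : K' ↪ K)
  {ψ : ∀ k', Λ₀ (e k') ↪ Ω}
  (hψ : ∀ k' j', k' ≠ j' → Disjoint ((Finset.univ : Finset (Λ₀ (e k'))).map (ψ k')) ((Finset.univ : Finset (Λ₀ (e j'))).map (ψ j')))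
  (hcompat : ∀ k' y, φ (e k') y = ω (ψ k' y))
include hφ hcompat

/-- **A sub-family of gates placed inside a window**: `Π_{k ∈ e(K')} Γ_{φ k} a_k = Γ_ω (Π_{k'} Γ_{ψ k'} a_{e k'})`.
[cite: ArakiMoriya2003, §4.1 Def. 4.3] -/
theorem boxProd_map_eq_fermionEmbed_boxProd :
    boxProd hφ a ha (Finset.univ.map e) =
      fermionEmbed ω (boxProd hψ (fun k' => a (e k')) (fun k' => ha (e k')) Finset.univ) := by
  rw [fermionEmbed_boxProd hψ (fun k' => ha (e k')) ω Finset.univ, boxProd, boxProd,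
    noncommProd_map_of_embedding]
  refine Finset.noncommProd_congr rfl (fun k' _ => ?_) _
  exact congrFun (congrArg DFunLike.coe (fermionEmbed_congr (hcompat k'))) (a (e k'))

/-- **Local form of the light cone for a sub-family of gates**: with the gates `e(K')` and the observable placed
inside the window `ω`, `W_{e(K')}ᴴ · Γ_{ι'≫ω}(x) · W_{e(K')} = Γ_ω (W'ᴴ · Γ_{ι'}(x) · W')`, `W' = Π_{k'} Γ_{ψ k'} a_{e k'}`.
[cite: BratteliRobinsonII1997, §5.2.2] -/
theorem conjTranspose_boxProd_map_mul_fermionEmbed_mul_eq {Ω₀ : Type*} [LinearOrder Ω₀] [Fintype Ω₀] (ι' : Ω₀ ↪ Ω)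
    (x : Matrix (Finset (Orb Ω₀)) (Finset (Orb Ω₀)) ℂ) :
    (boxProd hφ a ha (Finset.univ.map e))ᴴ * fermionEmbed (ι'.trans ω) x * boxProd hφ a ha (Finset.univ.map e) =
      fermionEmbed ω ((boxProd hψ (fun k' => a (e k')) (fun k' => ha (e k')) Finset.univ)ᴴ * fermionEmbed ι' x *
        boxProd hψ (fun k' => a (e k')) (fun k' => ha (e k')) Finset.univ) := by
  rw [boxProd_map_eq_fermionEmbed_boxProd hφ ha ω e hψ hcompat, map_mul, map_mul, fermionEmbed_conjTranspose,
    fermionEmbed_fermionEmbed]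

end LightCone

end Literature.MathematicalPhysics.QuantumLattice

end
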